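import Literature.Computability.Cryptography.RegevSamplerBlocksStd
import HarnessLib

/-!
# Regev 2009, Lemma 3.14 in machine form: the prepared register label as a WORD

Topic `Computability/Cryptography` (family `pqc`), grouping namespace `Regev2009.SamplerRegs`; sequel of
`RegevSamplerBlocksStd.lean` (the standard block embedding `stdEmb`) and `RegevSamplerGRLabel.lean` (`lab₀`, `boxLab`).

The inner uniform family of the sampler receives a classical INPUT WORD; the per-block analysis
(`tvDist_machineCircPar_le_std/canonical`) is stated for the register LABEL
`boxLab (stdEmb …) ws x₀ (lab₀ I Λ R t uz x') (fun _ => x₀ ∘ ws)`. This file writes that label as an explicit word, for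
layouts placed in order (`loc = id`, work window from `T` on — the standard / schedule layouts):

* `segWord a uz m n blk tl := 0^a ++ uz ++ 0^m ++ blk^n ++ 0^tl` and its letters (`getD_segWord_*`);
* `stdWord I Λ uz blk := segWord (n ℓ) uz (n ℓ_Y + n ℓ_R + n b_c) n blk (W − (base + n |blk|))`, `length_stdWord`;
* **`boxLab_stdEmb_eq_getD`** — letter `w` of the label is letter `w` of `stdWord I Λ uz ⟨x₀⟩`, for a block base
  content `x₀` blank on the point wires (`GRData.init`): point zone blank, input zone `uz`, zones `Y, S, A` blank, block
  `i`'s work wires `base + iB + q ↦ x₀ q`, the rest blank [Regev2009, Lemma 3.14 (proof: the registers)];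
* `boxLab_stdEmb_eq_get` — the same as an equality of register contents with `(stdWord …).get`.

Everything is proved; no named fact is introduced.
HONEST FRAMING: kernel-checked lemmas of a KNOWN reduction (Regev 2009) — not summit progress.

## References

* O. Regev, *On lattices, learning with errors, random linear codes, and cryptography*, J. ACM 56 (2009), art. 34:
  Lemma 3.14 (proof: the registers) [Regev2009].
* M. A. Nielsen, I. L. Chuang, *Quantum Computation and Quantum Information*, CUP 2010, §2.1.7, §4.5 [NielsenChuang2010].
-/

noncomputable section

namespace Literature.Computability.Cryptography

namespace Regev2009

namespace SamplerRegs

open Literature.Algebra.EuclideanLattices Literature.Algebra.EuclideanLattices.Regev2009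
  Literature.Algebra.EuclideanLattices.Regev2009.QPart Literature.Computability.QuantumComplexity
  Literature.Computability.QuantumComplexity.GroverRudolph Literature.Computability.Complexity SamplerFormats
  SamplerClassical SamplerClassical.Layout

/-! ### The segment word and its letters -/

section Seg

/-- **The segment word** `0^a ++ uz ++ 0^m ++ blk^n ++ 0^tl`. [cite: Regev2009, Lemma 3.14 (proof: the registers)] -/
def segWord (a : ℕ) (uz : List Bool) (m n : ℕ) (blk : List Bool) (tl : ℕ) : List Bool :=
  List.replicate a false ++ (uz ++ (List.replicate m false ++ ((List.replicate n blk).flatten ++ List.replicate tl false)))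

/-- Length of the repeated block. [folklore] -/
private theorem length_flatten_replicate (n : ℕ) (blk : List Bool) : ((List.replicate n blk).flatten).length = n * blk.length := by
  induction n with
  | zero => simp
  | succ n ih => rw [List.replicate_succ, List.flatten_cons, List.length_append, ih, Nat.succ_mul, Nat.add_comm]

/-- Letters of the repeated block. [folklore] -/
private theorem getD_flatten_replicate (blk : List Bool) :
    ∀ (n i q : ℕ), i < n → q < blk.length → ((List.replicate n blk).flatten).getD (i * blk.length + q) false = blk.getD q false := by
  intro n
  induction n with
  | zero => intro i q hi; exact absurd hi (Nat.not_lt_zero _)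
  | succ n ih =>
    intro i q hi hq
    rw [List.replicate_succ, List.flatten_cons]
    cases i with
    | zero => rw [Nat.zero_mul, Nat.zero_add, List.getD_append _ _ _ _ hq]
    | succ i =>
      rw [List.getD_append_right _ _ _ _ (by rw [Nat.succ_mul]; omega),
        show (i + 1) * blk.length + q - blk.length = i * blk.length + q by rw [Nat.succ_mul]; omega]
      exact ih i q (by omega) hq

/-- Letters of a blank run. [folklore] -/
private theorem getD_replicate_false (k w : ℕ) : (List.replicate k false).getD w false = false := by
  rw [List.getD_eq_getElem?_getD, List.getElem?_replicate]
  split_ifs <;> rfl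

/-- The length of the segment word. [cite: Regev2009, Lemma 3.14 (proof: the registers)] -/
theorem length_segWord (a : ℕ) (uz : List Bool) (m n : ℕ) (blk : List Bool) (tl : ℕ) :
    (segWord a uz m n blk tl).length = a + uz.length + m + n * blk.length + tl := by
  simp only [segWord, List.length_append, List.length_replicate, length_flatten_replicate]
  omega

/-- Segment 1 is blank. [cite: Regev2009, Lemma 3.14 (proof: the registers)] -/
theorem getD_segWord_1 (a : ℕ) (uz : List Bool) (m n : ℕ) (blk : List Bool) (tl : ℕ) {w : ℕ} (hw : w < a) :
    (segWord a uz m n blk tl).getD w false = false := by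
  rw [segWord, List.getD_append _ _ _ _ (by rw [List.length_replicate]; exact hw), getD_replicate_false]

/-- Segment 2 is `uz`. [cite: Regev2009, Lemma 3.14 (proof: the registers)] -/
theorem getD_segWord_2 (a : ℕ) (uz : List Bool) (m n : ℕ) (blk : List Bool) (tl : ℕ) {w : ℕ} (hw : a ≤ w)
    (hw' : w < a + uz.length) : (segWord a uz m n blk tl).getD w false = uz.getD (w - a) false := by
  rw [segWord, List.getD_append_right _ _ _ _ (by rw [List.length_replicate]; exact hw), List.length_replicate,
    List.getD_append _ _ _ _ (by omega)]

/-- Segment 3 is blank. [cite: Regev2009, Lemma 3.14 (proof: the registers)] -/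
theorem getD_segWord_3 (a : ℕ) (uz : List Bool) (m n : ℕ) (blk : List Bool) (tl : ℕ) {w : ℕ} (hw : a + uz.length ≤ w)
    (hw' : w < a + uz.length + m) : (segWord a uz m n blk tl).getD w false = false := by
  rw [segWord, List.getD_append_right _ _ _ _ (by rw [List.length_replicate]; omega), List.length_replicate,
    List.getD_append_right _ _ _ _ (by omega), List.getD_append _ _ _ _ (by rw [List.length_replicate]; omega),
    getD_replicate_false]

/-- Segment 4, block `i`, letter `q`. [cite: Regev2009, Lemma 3.14 (proof: the registers)] -/
theorem getD_segWord_4 (a : ℕ) (uz : List Bool) (m n : ℕ) (blk : List Bool) (tl : ℕ) {i q : ℕ} (hi : i < n)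
    (hq : q < blk.length) :
    (segWord a uz m n blk tl).getD (a + uz.length + m + (i * blk.length + q)) false = blk.getD q false := by
  have hlt : i * blk.length + q < n * blk.length :=
    calc i * blk.length + q < i * blk.length + blk.length := Nat.add_lt_add_left hq _
      _ = (i + 1) * blk.length := (Nat.succ_mul _ _).symm
      _ ≤ n * blk.length := Nat.mul_le_mul_right _ hi
  rw [segWord, List.getD_append_right _ _ _ _ (by rw [List.length_replicate]; omega), List.length_replicate,
    List.getD_append_right _ _ _ _ (by omega), List.getD_append_right _ _ _ _ (by rw [List.length_replicate]; omega),
    List.length_replicate, List.getD_append _ _ _ _ (by rw [length_flatten_replicate]; omega),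
    show a + uz.length + m + (i * blk.length + q) - a - uz.length - m = i * blk.length + q by omega]
  exact getD_flatten_replicate blk n i q hi hq

/-- Segment 5 and beyond is blank. [cite: Regev2009, Lemma 3.14 (proof: the registers)] -/
theorem getD_segWord_5 (a : ℕ) (uz : List Bool) (m n : ℕ) (blk : List Bool) (tl : ℕ) {w : ℕ}
    (hw : a + uz.length + m + n * blk.length ≤ w) : (segWord a uz m n blk tl).getD w false = false := by
  rw [segWord, List.getD_append_right _ _ _ _ (by rw [List.length_replicate]; omega), List.length_replicate,
    List.getD_append_right _ _ _ _ (by omega), List.getD_append_right _ _ _ _ (by rw [List.length_replicate]; omega),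
    List.length_replicate, List.getD_append_right _ _ _ _ (by rw [length_flatten_replicate]; omega), getD_replicate_false]

end Seg

/-- Writing a content's own point bits changes nothing. [folklore] -/
private theorem writeY_self {B ℓ : ℕ} (ws : Fin ℓ ↪ Fin B) (x₀ : QReg B) (q : Fin B) : writeY ws x₀ (x₀ ∘ ws) q = x₀ q := by
  by_cases hq : q ∈ Set.range ws
  · obtain ⟨j, rfl⟩ := hq
    rw [writeY_apply_ws, Function.comp_apply]
  · exact writeY_apply_of_not_mem ws x₀ _ hq

/-! ### The standard word -/

variable {W B : ℕ} (I : LatticeInstance) {Λ : Layout W I.n} (hΛ : Λ.OK)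

/-- **The standard word of a layout placed in order**: point zone blank, input zone `uz`, zones `Y, S, A` blank, then
the `n` work blocks `blk`, then blank to the end. [cite: Regev2009, Lemma 3.14 (proof: the registers)] -/
def stdWord (Λ : Layout W I.n) (uz blk : List Bool) : List Bool :=
  segWord (I.n * Λ.ℓ) uz Λ.regLen I.n blk (W - (Λ.base + I.n * blk.length))

/-- The length of the standard word is the register width. [cite: Regev2009, Lemma 3.14 (proof: the registers)] -/
theorem length_stdWord (hbT : Λ.base = Λ.T) {uz blk : List Bool} (huz : uz.length = Λ.L) (hroom : Λ.base + I.n * blk.length ≤ W) :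
    (stdWord I Λ uz blk).length = W := by
  rw [stdWord, length_segWord, huz]
  have hT := Λ.T_eq
  unfold Layout.regLen
  omega

include hΛ in
/-- **The block label over the prepared label is the standard word**, letter by letter, for a layout placed in order
(`loc = id`, `base = T`), the standard blocks with point wires `ws j = j`, a block base content blank on the point wires,
and an input-zone content of length `L`. [cite: Regev2009, Lemma 3.14 (proof: the registers)] [cite: NielsenChuang2010, §2.1.7] -/
theorem boxLab_stdEmb_eq_getD (hloc : ∀ i, Λ.loc i = i) (hbT : Λ.base = Λ.T) (ws : Fin Λ.ℓ ↪ Fin B)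
    (hws : ∀ j, (ws j : ℕ) = j) (hroom : Λ.base + I.n * B ≤ W) (x₀ : QReg B) (hx₀ : ∀ q : Fin B, (q : ℕ) < Λ.ℓ → x₀ q = false)
    (R : ℕ) (t : ℝ) (uz : List Bool) (huz : uz.length = Λ.L) (x' : EuclideanSpace ℝ (Fin I.n)) (w : Fin W) :
    boxLab (stdEmb I hΛ hroom) ws x₀ (lab₀ I Λ R t uz x') (fun _ => x₀ ∘ ws) w = (stdWord I Λ uz (List.ofFn x₀)).getD w false := by
  have hT := Λ.T_eq
  obtain ⟨hU', hY', -, -, -⟩ := offs_eq I Λ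
  have hfit := blocksFit_stdEmb I hΛ ws hws hroom
  have hfin : ∀ s, s < Λ.T → (Λ.fin s : ℕ) = s := fun s hs => by rw [Layout.fin_val hΛ hs, hloc]
  have hreg : Λ.regLen = I.n * Λ.ℓY + I.n * Λ.ℓR + I.n * Λ.bc := rfl
  have hget : ∀ q : Fin B, (List.ofFn x₀).getD q false = x₀ q := fun q => by
    rw [List.getD_eq_getElem _ _ (by rw [List.length_ofFn]; exact q.2), List.getElem_ofFn]
  have hblk : ∀ (i q : ℕ) (hi : i < I.n) (hq : q < B),
      (stdWord I Λ uz (List.ofFn x₀)).getD (Λ.base + (i * B + q)) false = x₀ ⟨q, hq⟩ := by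
    intro i q hi hq
    have h4 := getD_segWord_4 (I.n * Λ.ℓ) uz Λ.regLen I.n (List.ofFn x₀) (W - (Λ.base + I.n * (List.ofFn x₀).length)) hi
      (q := q) (by rw [List.length_ofFn]; exact hq)
    rw [List.length_ofFn, huz, show I.n * Λ.ℓ + Λ.L + Λ.regLen = Λ.base by rw [hbT, hT, hreg]; omega] at h4
    rw [stdWord, List.length_ofFn, h4, hget ⟨q, hq⟩]
  by_cases hw : ∃ p : Fin I.n × Fin B, stdEmb I hΛ hroom p.1 p.2 = w
  · obtain ⟨⟨i, q⟩, rfl⟩ := hw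
    rw [boxLab_apply_block ws x₀ _ hfit.disj, writeY_self, stdEmb_apply]
    by_cases hq : (q : ℕ) < Λ.ℓ
    · have hlt : (i : ℕ) * Λ.ℓ + q < I.n * Λ.ℓ := blk_lt i ⟨q, hq⟩
      rw [hx₀ q hq, show (stdEmbFun I hroom i q : ℕ) = (i : ℕ) * Λ.ℓ + q by
          unfold stdEmbFun; rw [if_pos hq]; exact hfin ((i : ℕ) * Λ.ℓ + q) (by omega)]
      exact (getD_segWord_1 _ _ _ _ _ _ hlt).symm
    · rw [stdEmbFun_val_of_le I hroom i q (Nat.not_lt.1 hq)]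
      exact (hblk i q i.2 q.2).symm
  · have hoff : OffBlocks (stdEmb I hΛ hroom) w := fun i ⟨q, hq⟩ => hw ⟨(i, q), hq⟩
    rw [boxLab_apply_off ws x₀ _ _ hoff]
    by_cases h1 : (w : ℕ) < I.n * Λ.ℓ
    · obtain ⟨i, j, hij⟩ := exists_block_of_lt I hfit h1
      exact absurd ⟨(i, ws j), by rw [← hij]; exact Fin.ext (hfin (w : ℕ) (by omega))⟩ hw
    by_cases h2 : (w : ℕ) < I.n * Λ.ℓ + Λ.L
    · have hv : lab₀ I Λ R t uz x' w = uz.getD ((w : ℕ) - I.n * Λ.ℓ) false := by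
        have e : Λ.fin (Λ.oU + ((w : ℕ) - I.n * Λ.ℓ)) = w :=
          Fin.ext (by rw [hfin (Λ.oU + ((w : ℕ) - I.n * Λ.ℓ)) (by omega)]; omega)
        have h := lab₀_U I hΛ R t uz x' (s := (w : ℕ) - I.n * Λ.ℓ) (by omega)
        rwa [e] at h
      rw [hv]
      exact (getD_segWord_2 _ _ _ _ _ _ (Nat.not_lt.1 h1) (by rw [huz]; exact h2)).symm
    by_cases h3 : (w : ℕ) < Λ.base
    · have hv : lab₀ I Λ R t uz x' w = false := by
        have e : Λ.fin (w : ℕ) = w := Fin.ext (hfin (w : ℕ) (by omega))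
        have h := lab₀_R I hΛ R t uz x' (s := (w : ℕ)) (by omega) (by omega)
        rwa [e] at h
      rw [hv]
      exact (getD_segWord_3 _ _ _ _ _ _ (by rw [huz]; omega) (by rw [huz, hreg]; omega)).symm
    rw [lab₀_window I hΛ R t uz x' w (Nat.not_lt.1 h3)]
    by_cases h4 : (w : ℕ) < Λ.base + I.n * B
    · have hB : 0 < B := Nat.pos_of_ne_zero fun hB => by rw [hB, Nat.mul_zero, Nat.add_zero] at h4; exact h3 h4
      have hi' : ((w : ℕ) - Λ.base) / B < I.n := (Nat.div_lt_iff_lt_mul hB).2 (by omega)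
      have hq' : ((w : ℕ) - Λ.base) % B < B := Nat.mod_lt _ hB
      have hwv : (w : ℕ) = Λ.base + (((w : ℕ) - Λ.base) / B * B + ((w : ℕ) - Λ.base) % B) := by
        have := Nat.div_add_mod' ((w : ℕ) - Λ.base) B
        omega
      have hval := hblk _ _ hi' hq'
      rw [← hwv] at hval
      rw [hval]
      by_cases hqℓ : ((w : ℕ) - Λ.base) % B < Λ.ℓ
      · exact (hx₀ _ hqℓ).symm
      · exfalso
        refine hw ⟨(⟨_, hi'⟩, ⟨_, hq'⟩), Fin.ext ?_⟩
        rw [stdEmb_apply, stdEmbFun_val_of_le I hroom _ _ (Nat.not_lt.1 hqℓ)]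
        exact hwv.symm
    · symm
      refine getD_segWord_5 _ _ _ _ _ _ ?_
      rw [huz, List.length_ofFn, hreg]
      omega

include hΛ in
/-- **The block label over the prepared label is the register content read from the standard word.**
[cite: Regev2009, Lemma 3.14 (proof: the registers)] [cite: NielsenChuang2010, §2.1.7, §4.5] -/
theorem boxLab_stdEmb_eq_get (hloc : ∀ i, Λ.loc i = i) (hbT : Λ.base = Λ.T) (ws : Fin Λ.ℓ ↪ Fin B)
    (hws : ∀ j, (ws j : ℕ) = j) (hroom : Λ.base + I.n * B ≤ W) (x₀ : QReg B) (hx₀ : ∀ q : Fin B, (q : ℕ) < Λ.ℓ → x₀ q = false)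
    (R : ℕ) (t : ℝ) (uz : List Bool) (huz : uz.length = Λ.L) (x' : EuclideanSpace ℝ (Fin I.n))
    (hlen : (stdWord I Λ uz (List.ofFn x₀)).length = W) (i : Fin (stdWord I Λ uz (List.ofFn x₀)).length) :
    (stdWord I Λ uz (List.ofFn x₀)).get i = boxLab (stdEmb I hΛ hroom) ws x₀ (lab₀ I Λ R t uz x') (fun _ => x₀ ∘ ws) (Fin.cast hlen i) := by
  rw [boxLab_stdEmb_eq_getD I hΛ hloc hbT ws hws hroom x₀ hx₀ R t uz huz x', Fin.val_cast, List.get_eq_getElem,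
    List.getD_eq_getElem _ _ i.2]

end SamplerRegs

end Regev2009

end Literature.Computability.Cryptography

end
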